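import Literature.Analysis.FluidPDE.SteadyStrainedNS
import Literature.Analysis.FluidPDE.GaussianVortexPlanar
import Literature.Analysis.FluidPDE.SwirlTransportProofs
import HarnessLib

/-!
# The Burgers vortex: the exact steady vortex tube in an axisymmetric strain on `ℝ³`

Analysis/FluidPDE definitions file (work item `defn-BurgersVortexInStrain`, part (a); wanted by
route `FrozenK41` of `AnomalousDissipation`, items 1214–1216). In the axisymmetric strain
`U_s(x) = (−γx₀/2, −γx₁/2, γx₂)` (`axisymmetricStrain γ`), viscosity `ν`, total circulation `Γ`:

* `burgersVorticity γ ν Γ x = (γΓ/4πν) exp(−γ(x₀²+x₁²)/4ν)` — the axial vorticity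
  (Frisch 1995, eq. (8.140); Burgers 1948; Gallay–Maekawa 2016, (1.21): `ω = Γ(γ/ν) G(x√(γ/ν))`,
  proved as `burgersVorticity_eq_gaussVortexProfile`);
* `burgersVortexSwirl γ ν Γ` — the azimuthal velocity `(Γ/2πr²)(1 − e^{−γr²/4ν}) (−x₁, x₀, 0)`
  (Gallay–Maekawa 2016, (1.21)–(1.22)), junk-free via `burgersPhi` (smooth on the axis);
* `burgersVortex γ ν Γ = axisymmetricStrain γ + burgersVortexSwirl γ ν Γ` — the full field;
* `burgersCoreRadius γ ν = (ν/γ)^{1/2}` (Gallay–Wayne 2006, p. 2: `δ = (ν/γ)^{1/2}`,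
  `ω = (Γ/δ²) G(x/δ)`), `horizLift` (cross-section embedding);
* proved API: smoothness, the printed closed forms off the axis, positivity and the axis maximum
  `γΓ/(4πν)` of `ω`, and the total circulation `∫_{ℝ²} ω = Γ`.

That `burgersVortex` is an exact steady Navier–Stokes solution is PROVED in `BurgersVortexSteady`;
the layer is `BurgersVortexLayer`; energetics and literature facts: `BurgersVortexFacts`,
`GaussianVortexPlanar`.

## References

* J. M. Burgers, *A mathematical model illustrating the theory of turbulence*, Adv. Appl. Mech. 1
  (1948) 171–199.
* U. Frisch, *Turbulence*, CUP (1995), §8.9.1, eq. (8.140), PDF p. 140. [Frisch1995]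
* Th. Gallay, C. E. Wayne, arXiv:math/0503353, §1, (1.4)–(1.5). [GallayWayne2006]
* Th. Gallay, Y. Maekawa, arXiv:1610.08384, §1 (1.21)–(1.22). [GallayMaekawa2016]
-/

noncomputable section

open Set Function Filter Topology WithLp MeasureTheory
open scoped Laplacian InnerProductSpace RealInnerProductSpace ContDiff

namespace Literature.Analysis.FluidPDE

/-- Local notation for physical space `ℝ³ = EuclideanSpace ℝ (Fin 3)`. -/
local notation "ℝ³" => EuclideanSpace ℝ (Fin 3)
/-- Local notation for the cross-section plane `ℝ² = EuclideanSpace ℝ (Fin 2)`. -/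
local notation "ℝ²" => EuclideanSpace ℝ (Fin 2)

/-! ### The axisymmetric Burgers vortex -/

/-- The **Burgers vorticity** `ω(x) = (γΓ/4πν) exp(−γ(x₀² + x₁²)/(4ν))`, the axial (`e_z`)
component of the vorticity of the Burgers vortex with strain rate `γ`, viscosity `ν` and total
circulation `Γ` (Frisch 1995, eq. (8.140); Burgers 1948; Gallay–Maekawa 2016, (1.21):
`ω = Γ(γ/ν) G(x√(γ/ν))`, see `burgersVorticity_eq_gaussVortexProfile`). A function on `ℝ³`
independent of `x₂`. [cite: Frisch1995, §8.9.1 eq. (8.140)] -/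
def burgersVorticity (γ ν Γ : ℝ) (x : ℝ³) : ℝ :=
  γ * Γ / (4 * Real.pi * ν) * Real.exp (-(γ * (x 0 ^ 2 + x 1 ^ 2) / (4 * ν)))

/-- The **swirl velocity of the Burgers vortex** (the perturbation `v` of the strain):
`v(x) = (Γ/2πr²)(1 − e^{−γr²/4ν}) (−x₁, x₀, 0)`, `r² = x₀² + x₁²` (Gallay–Maekawa 2016,
(1.21)–(1.22): `v = Γ√(γ/ν) v^G(x√(γ/ν))`; Gallay–Wayne 2006, (1.4)–(1.5)), written junk-free as
`(γΓ/8πν) φ(γr²/4ν) • J x` with `φ = burgersPhi`, `J = rotGen` (printed form: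
`burgersVortexSwirl_eq_of_ne_zero`). Azimuthal, independent of `x₂`, smooth on all of `ℝ³`. [cite: GallayMaekawa2016, (1.21)–(1.22)] -/
def burgersVortexSwirl (γ ν Γ : ℝ) (x : ℝ³) : ℝ³ :=
  (γ * Γ / (8 * Real.pi * ν) * burgersPhi (γ * (x 0 ^ 2 + x 1 ^ 2) / (4 * ν))) • rotGen x

/-- The **Burgers vortex** `u = U_s + v`: axisymmetric strain plus the Burgers swirl — the exact
steady solution of the Navier–Stokes equations in `ℝ³` "with vanishing nonlinearity"
(Frisch 1995, §8.9.1; Burgers 1948; Gallay–Maekawa 2016, (1.21)). [cite: Frisch1995, §8.9.1 eq. (8.140)] -/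
def burgersVortex (γ ν Γ : ℝ) : ℝ³ → ℝ³ :=
  axisymmetricStrain γ + burgersVortexSwirl γ ν Γ

/-- The **core radius** `δ = (ν/γ)^{1/2}` of the Burgers vortex (Gallay–Wayne 2006, p. 2: the
natural length scale defined by viscosity and strain; `ω = (Γ/δ²) G(x/δ)`). [cite: GallayWayne2006, §1 (1.4)] -/
def burgersCoreRadius (γ ν : ℝ) : ℝ :=
  Real.sqrt (ν / γ)

/-- `δ² = ν/γ` for `ν/γ ≥ 0`. [folklore] -/
theorem burgersCoreRadius_sq {γ ν : ℝ} (h : 0 ≤ ν / γ) : burgersCoreRadius γ ν ^ 2 = ν / γ :=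
  Real.sq_sqrt h

/-- The Burgers vorticity in terms of the core radius: `ω(x) = (Γ/(4πδ²)) e^{−r²/(4δ²)}` for
`γ, ν > 0` (Gallay–Wayne 2006, (1.4): `ω^Γ = (Γ/δ²) G(x/δ)`). [cite: GallayWayne2006, (1.4)] -/
theorem burgersVorticity_eq_coreRadius {γ ν : ℝ} (hγ : 0 < γ) (hν : 0 < ν) (Γ : ℝ) (x : ℝ³) :
    burgersVorticity γ ν Γ x =
      Γ / (4 * Real.pi * burgersCoreRadius γ ν ^ 2) *
        Real.exp (-((x 0 ^ 2 + x 1 ^ 2) / (4 * burgersCoreRadius γ ν ^ 2))) := by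
  rw [burgersCoreRadius_sq (div_pos hν hγ).le, burgersVorticity]
  congr 1
  · field_simp
  · congr 1
    field_simp

/-- The horizontal embedding of the cross-section plane at height `c`: `(y₀, y₁) ↦ (y₀, y₁, c)`. [folklore] -/
def horizLift (y : ℝ²) (c : ℝ) : ℝ³ :=
  toLp 2 ![y 0, y 1, c]

/-- Components of the horizontal embedding. [folklore] -/
@[simp] theorem horizLift_apply_zero (y : ℝ²) (c : ℝ) : horizLift y c 0 = y 0 := rfl

/-- Components of the horizontal embedding. [folklore] -/
@[simp] theorem horizLift_apply_one (y : ℝ²) (c : ℝ) : horizLift y c 1 = y 1 := rfl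

/-- Components of the horizontal embedding. [folklore] -/
@[simp] theorem horizLift_apply_two (y : ℝ²) (c : ℝ) : horizLift y c 2 = c := rfl

/-- `|y|² = y₀² + y₁²` on `ℝ²`. [folklore] -/
theorem norm_sq_eq_two (y : ℝ²) : ‖y‖ ^ 2 = y 0 ^ 2 + y 1 ^ 2 := by
  rw [EuclideanSpace.norm_sq_eq, Fin.sum_univ_two]
  simp [sq_abs]

/-- **`ω = Γ(γ/ν) G(x√(γ/ν))`** on each cross-section (Gallay–Maekawa 2016, (1.21)), for
`γ, ν > 0`. [cite: GallayMaekawa2016, (1.21)] -/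
theorem burgersVorticity_eq_gaussVortexProfile {γ ν : ℝ} (hγ : 0 < γ) (hν : 0 < ν) (Γ : ℝ)
    (y : ℝ²) (c : ℝ) :
    burgersVorticity γ ν Γ (horizLift y c) =
      Γ * (γ / ν) * gaussVortexProfile (Real.sqrt (γ / ν) • y) := by
  rw [burgersVorticity, gaussVortexProfile, norm_smul, mul_pow, Real.norm_eq_abs, sq_abs,
    Real.sq_sqrt (div_pos hγ hν).le, norm_sq_eq_two]
  simp only [horizLift_apply_zero, horizLift_apply_one]
  rw [show γ * (y 0 ^ 2 + y 1 ^ 2) / (4 * ν) = γ / ν * (y 0 ^ 2 + y 1 ^ 2) / 4 by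
    field_simp]
  field_simp

/-- The printed closed form of the swirl off the axis:
`v(x) = (Γ/(2π r²)) (1 − e^{−γr²/(4ν)}) • (−x₁, x₀, 0)` for `r² = x₀² + x₁² ≠ 0`, `γ, ν ≠ 0`
(Gallay–Maekawa 2016, (1.21)–(1.22)). [cite: GallayMaekawa2016, (1.21)–(1.22)] -/
theorem burgersVortexSwirl_eq_of_ne_zero {γ ν : ℝ} (hγ : γ ≠ 0) (hν : ν ≠ 0) (Γ : ℝ) {x : ℝ³}
    (hx : x 0 ^ 2 + x 1 ^ 2 ≠ 0) :
    burgersVortexSwirl γ ν Γ x =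
      (Γ / (2 * Real.pi * (x 0 ^ 2 + x 1 ^ 2)) *
        (1 - Real.exp (-(γ * (x 0 ^ 2 + x 1 ^ 2) / (4 * ν))))) • rotGen x := by
  have ht : γ * (x 0 ^ 2 + x 1 ^ 2) / (4 * ν) ≠ 0 := by
    refine div_ne_zero (mul_ne_zero hγ hx) (mul_ne_zero (by norm_num) hν)
  rw [burgersVortexSwirl, burgersPhi_of_ne_zero ht]
  congr 1
  field_simp
  ring

/-- The swirl is horizontal: its axial component vanishes. [folklore] -/
@[simp] theorem burgersVortexSwirl_apply_two (γ ν Γ : ℝ) (x : ℝ³) : burgersVortexSwirl γ ν Γ x 2 = 0 := by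
  simp [burgersVortexSwirl]

/-- The swirl is azimuthal: `⟪v(x), x⟫ = 0`. [folklore] -/
theorem inner_burgersVortexSwirl_self (γ ν Γ : ℝ) (x : ℝ³) : ⟪burgersVortexSwirl γ ν Γ x, x⟫ = 0 := by
  rw [burgersVortexSwirl, inner_smul_left, inner_rotGen_self, mul_zero]

/-- The swirl does not depend on the axial coordinate: it factors through the cross-section. [folklore] -/
theorem burgersVortexSwirl_horizLift (γ ν Γ : ℝ) (x : ℝ³) :
    burgersVortexSwirl γ ν Γ x = burgersVortexSwirl γ ν Γ (horizLift (toLp 2 ![x 0, x 1]) 0) := by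
  have hr : rotGen (horizLift (toLp 2 ![x 0, x 1]) 0) = rotGen x := by
    ext i; fin_cases i <;> rfl
  have h0 : (horizLift (toLp 2 ![x 0, x 1]) 0) 0 = x 0 := rfl
  have h1 : (horizLift (toLp 2 ![x 0, x 1]) 0) 1 = x 1 := rfl
  rw [burgersVortexSwirl, burgersVortexSwirl, hr, h0, h1]

/-- The scalar coefficient `x ↦ γ(x₀² + x₁²)/(4ν)` is smooth. [folklore] -/
theorem contDiff_strainArg (γ ν : ℝ) {n : WithTop ℕ∞} :
    ContDiff ℝ n (fun x : ℝ³ => γ * (x 0 ^ 2 + x 1 ^ 2) / (4 * ν)) := by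
  have h0 : ContDiff ℝ n (fun x : ℝ³ => x 0) := contDiff_piLp_apply (p := 2)
  have h1 : ContDiff ℝ n (fun x : ℝ³ => x 1) := contDiff_piLp_apply (p := 2)
  exact ((contDiff_const.mul ((h0.pow 2).add (h1.pow 2))).div_const _)

/-- **The Burgers swirl is smooth on all of `ℝ³`** (including the axis, thanks to the entire
profile `φ`). [folklore] -/
theorem contDiff_burgersVortexSwirl (γ ν Γ : ℝ) {n : WithTop ℕ∞} :
    ContDiff ℝ n (burgersVortexSwirl γ ν Γ) := by
  unfold burgersVortexSwirl
  refine ContDiff.smul (contDiff_const.mul (contDiff_burgersPhi.comp (contDiff_strainArg γ ν))) ?_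
  have h : rotGen = fun x => rotGenL x := funext fun x => (rotGenL_apply x).symm
  rw [h]; exact rotGenL.contDiff

/-- The Burgers vortex is a smooth vector field on `ℝ³`. [folklore] -/
theorem contDiff_burgersVortex (γ ν Γ : ℝ) {n : WithTop ℕ∞} : ContDiff ℝ n (burgersVortex γ ν Γ) :=
  (contDiff_axisymmetricStrain γ).add (contDiff_burgersVortexSwirl γ ν Γ)

/-- The Burgers vorticity is smooth. [folklore] -/
theorem contDiff_burgersVorticity (γ ν Γ : ℝ) {n : WithTop ℕ∞} : ContDiff ℝ n (burgersVorticity γ ν Γ) :=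
  contDiff_const.mul (Real.contDiff_exp.comp (contDiff_strainArg γ ν).neg)

/-- The Burgers vorticity is positive for `γΓ/ν > 0`-sign data: precisely `ω(x)` has the sign of
`γΓ/ν`; in particular `0 < ω` for `γ, ν, Γ > 0`. [folklore] -/
theorem burgersVorticity_pos {γ ν Γ : ℝ} (hγ : 0 < γ) (hν : 0 < ν) (hΓ : 0 < Γ) (x : ℝ³) :
    0 < burgersVorticity γ ν Γ x := by
  unfold burgersVorticity
  positivity

/-- The vorticity is maximal on the axis: `ω(x) ≤ ω(axis) = γΓ/(4πν)` for `γ, ν, Γ > 0`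
(Gaussian profile). [folklore] -/
theorem burgersVorticity_le_axis {γ ν Γ : ℝ} (hγ : 0 < γ) (hν : 0 < ν) (hΓ : 0 ≤ Γ) (x : ℝ³) :
    burgersVorticity γ ν Γ x ≤ γ * Γ / (4 * Real.pi * ν) := by
  unfold burgersVorticity
  have hc : 0 ≤ γ * Γ / (4 * Real.pi * ν) := by positivity
  have he : Real.exp (-(γ * (x 0 ^ 2 + x 1 ^ 2) / (4 * ν))) ≤ 1 := by
    rw [Real.exp_le_one_iff, neg_nonpos]; positivity
  simpa using mul_le_mul_of_nonneg_left he hc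

/-- **Total circulation.** The Burgers vorticity integrates to `Γ` over every cross-section:
`∫_{ℝ²} ω(y, c) dy = Γ` for `γ, ν > 0` (Frisch 1995, after (8.140): "`Γ` is the total circulation";
Gallay–Wayne 2006, p. 2: `Γ = ∫ ω^Γ`). Gaussian integral `∫_{ℝ²} e^{−b|y|²} = π/b`. [cite: Frisch1995, §8.9.1 eq. (8.140)] -/
theorem integral_burgersVorticity {γ ν : ℝ} (hγ : 0 < γ) (hν : 0 < ν) (Γ c : ℝ) :
    ∫ y : ℝ², burgersVorticity γ ν Γ (horizLift y c) = Γ := by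
  have hb : 0 < γ / (4 * ν) := by positivity
  have hG := GaussianFourier.integral_rexp_neg_mul_sq_norm (V := ℝ²) hb
  rw [finrank_euclideanSpace_fin, show ((2 : ℕ) : ℝ) / 2 = 1 by norm_num, Real.rpow_one] at hG
  have h : ∀ y : ℝ², burgersVorticity γ ν Γ (horizLift y c) =
      γ * Γ / (4 * Real.pi * ν) * Real.exp (-(γ / (4 * ν)) * ‖y‖ ^ 2) := fun y => by
    rw [burgersVorticity, norm_sq_eq_two]
    simp only [horizLift_apply_zero, horizLift_apply_one]
    congr 2
    ring
  simp_rw [h, integral_const_mul, hG]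
  field_simp

/-- **Enstrophy and dissipation per unit length.** The enstrophy of a cross-section of the
Burgers vortex is `∫_{ℝ²} ω² dy = γΓ²/(8πν)`, i.e.

  `ν ∫_{ℝ²} ω(y, c)² dy = γΓ²/(8π)`   for `γ, ν > 0`,

INDEPENDENT of the viscosity. For the planar, divergence-free swirl `v` (`v = O(r⁻¹)`,
`∇v = O(r⁻²)`, `|∇v|² − ω²` a divergence) the classical identity `∫_{ℝ²} |∇v|² = ∫_{ℝ²} ω²`
turns this into the viscous dissipation rate per unit length of the tube,
`ν ∫_{ℝ²} |∇v|² = γΓ²/(8π)` (Burgers 1948: the dissipation of the strained vortex is fixed by the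
strain and the circulation, not by `ν`). Gaussian integral `∫_{ℝ²} e^{−b|y|²} = π/b` with
`b = γ/(2ν)`. [folklore] -/
theorem burgersVortex_enstrophy_dissipation {γ ν : ℝ} (hγ : 0 < γ) (hν : 0 < ν) (Γ c : ℝ) :
    ν * ∫ y : ℝ², burgersVorticity γ ν Γ (horizLift y c) ^ 2 = γ * Γ ^ 2 / (8 * Real.pi) := by
  have hb : 0 < γ / (2 * ν) := by positivity
  have hG := GaussianFourier.integral_rexp_neg_mul_sq_norm (V := ℝ²) hb
  rw [finrank_euclideanSpace_fin, show ((2 : ℕ) : ℝ) / 2 = 1 by norm_num, Real.rpow_one] at hG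
  have h : ∀ y : ℝ², burgersVorticity γ ν Γ (horizLift y c) ^ 2 =
      (γ * Γ / (4 * Real.pi * ν)) ^ 2 * Real.exp (-(γ / (2 * ν)) * ‖y‖ ^ 2) := fun y => by
    rw [burgersVorticity, norm_sq_eq_two, mul_pow, sq (Real.exp _), ← Real.exp_add]
    simp only [horizLift_apply_zero, horizLift_apply_one]
    congr 2
    ring
  simp_rw [h, integral_const_mul, hG]
  field_simp
  ring

end Literature.Analysis.FluidPDE
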